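import Summits.QuantumFields.YangMills.Theorems.BalabanUVNodesN15KingModelTorusReflectionPositivityAllPlanes
import Literature.Probability.LatticeModels.GaussianPrecisionReflectionPositivitySites
import HarnessLib

/-!
# BalabanUVNodes ∕ N15 — THE KING-MODEL RUNG (PART Ϗ-d): KING's FINE FREE FIELD IS REFLECTION POSITIVE FOR REFLECTIONS THROUGH SITES —
# `x_κ ↦ −x_κ` (dag-n15-a's `torNeg`) with the closed half torus `{val x_κ ≤ K_κ∕2}`, on EVERY finite torus (even OR odd side), every direction, and all its
# translates `x_κ ↦ 2t_κ − x_κ` — LITERALLY the tree's FILS `Torus.reflectThroughSites κ k` ∕ `Torus.halfThroughSites κ k`; mechanism: the MARKOV form of the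
# precision criterion (no nearest-neighbour bond joins the two open half-spaces)
# (Track A, DAG node N15 = NE2; FAN-OUT v1.1 §N15 s3 «KING-MODEL RUNG»; count-neutral)

HONEST FRAMING.  Count-neutral (cell `pub-ymgap`, seat `pub-ymgap-dag-n15-e` g37; `--supports stmt-QuantumFields-27366 --as helper` = K3⁸).  King's `A = 0`, `g = 0` model
([King1986] (2.13) p.653, (4.4) p.670): the fine free covariance `B⁻¹`, `B = c(−Δ) + m²` on `Π_μ ℤ∕K_μ`.  Parts Ϗ-a∕b∕c treat the reflections BETWEEN sites (block
faces; even side).  HERE: reflections THROUGH sites, `σ′_κ x = (…, −x_κ, …)` (dag-n15-a's `torNeg K κ`), fixing the hyperplanes `x_κ = 0` and (even side)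
`x_κ = K_κ∕2`, with the CLOSED half torus `P = {val x_κ ≤ K_κ∕2}` (Biskup's `𝕋_L^+`, `𝕋_L^+ ∩ 𝕋_L^- =` the fixed hyperplanes).  The halves cover the torus and
overlap only in fixed points (★ `torNeg_mem_half_of_not_mem`, ★ `torNeg_eq_self_of_mem`) for EVERY `K_κ ≥ 1` — no parity is needed (for odd `K_κ` the antipodal
face lies between sites and its one crossing bond joins a site to its own mirror image).  By the new Literature criterion with a fixed hyperplane
(`GaussianPrecisionReflectionPositivitySites`): no bond of `B` joins the two OPEN half-spaces except a site to its mirror image (★ `eq_of_cut_bond_sites`), so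
the cut hypothesis holds (`lapF_cut_nonpos_sites`) and ★★★ **`freeField_isReflectionPositive_throughSites`**: `N(0, B⁻¹)` is reflection positive on all bounded
observables measurable in `{φ(x) : val x_κ ≤ K_κ∕2}`, every direction, every finite torus, `c ≥ 0`, `m² > 0`.  Translates: ★★★ `freeField_isReflectionPositive_throughSites_plane`
(`x_κ ↦ 2t_κ − x_κ`, half `{val (x−t)_κ ≤ K_κ∕2}`), and on constant tori `(ℤ∕n)^{d+1}` IN THE TREE's VOCABULARY ★★★ **`freeField_isReflectionPositive_reflectThroughSites`**:
`IsReflectionPositive (N(0,B⁻¹)) (Torus.reflectThroughSites κ k) (Torus.halfThroughSites κ k)` for every `κ`, `k` (★ `siteRefl_eq_reflectThroughSites`,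
★ `siteHalf_eq_halfThroughSites`).  NOT for the block fields (the block-spin term `Q*Q` and the unit-lattice precision `Δ^{(K)}` are not site-reflection local —
honest scope); NOT Bałaban's objects; NOT a node discharge; nothing continuum ∕ `ℝ⁴` ∕ OS axioms ∕ mass gap ∕ Clay.  0 `sorry`, 0 `def`.

WHAT THIS FILE PROVES (kernel).  §1 `torNeg_eq_torRefl_add`, `val_torNeg`, ★ `torNeg_mem_half_of_not_mem`, ★ `torNeg_eq_self_of_mem`, `two_mul_val_ne_of_ne`,
★ `eq_of_cut_bond_sites`; §2 `lapF_torNeg`, `lapF_inv_torNeg`, `lapF_apply_torNeg_of_ne`, `lapF_apply_torNeg_self_nonpos`, `lapF_cut_nonpos_sites`,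
★★★ **`freeField_isReflectionPositive_throughSites`**, `freeField_isReflectionPositiveReal_throughSites`, `lapF_inv_sites_base_nonneg`; §3 `siteShiftedRefl_involutive`,
★★★ `freeField_isReflectionPositive_throughSites_plane`; §4 ★ `siteRefl_eq_reflectThroughSites`, ★ `siteHalf_eq_halfThroughSites`, ★★★ **`freeField_isReflectionPositive_reflectThroughSites`**,
★★ `kingFineField_isReflectionPositive_reflectThroughSites` (King's fine torus `Π ℤ∕(L^K·2L^m)`, `c = N²`).

Locators (use): [King1986] (2.13) p.653, (4.4) p.670; Glimm–Jaffe 1987 §7.10 Thm. 7.10.3; FILS 1978 §2 (reflections through sites), Thm. 2.1; Biskup 2009 §5.1 Def. 5.2.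
-/

noncomputable section

open scoped BigOperators
open Finset Matrix MeasureTheory

namespace Summit.QuantumFields.YangMills.BalabanUVNodes.N15KingModelRung.TorusRP

open Literature.MathematicalPhysics.QuantumFieldTheory (IsPosSemidefKernel gaussianFieldOfKernel)
open Literature.MathematicalPhysics.QuantumFieldTheory.Balaban1983to89.B5Prop11Plancherel (Tor fine unitVec)
open Literature.MathematicalPhysics.QuantumFieldTheory.King1986.Torus (lapF lapF_comm lapF_coercive lapF_transl)
open Literature.Probability.LatticeModels (IsReflectionPositive IsReflectionPositiveReal IsReflectionInvariant
  reflectedCovariance_nonneg_of_precision_sites' isPosSemidefKernel_inv_of_posDef gaussianField_isReflectionPositive_of_precision_sites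
  gaussianField_isReflectionPositiveReal_of_precision_sites gaussianField_isReflectionPositive_of_vector inv_apply_equiv_of_invariant cut_nonpos_of_noCoupling)
open Literature.Probability.LatticeModels.Torus (reflectThroughSites halfThroughSites reflectThroughSites_apply)
open Summit.QuantumFields.YangMills.BalabanUVNodes.N15.TwoGrid (torRefl torNeg torRefl_torRefl torNeg_torNeg torRefl_apply_same torRefl_apply_ne
  torNeg_apply_same torNeg_apply_ne)
open Summit.QuantumFields.YangMills.BalabanUVNodes.N15.KingModel.SrcDiv (lapF_torRefl)
open Summit.QuantumFields.YangMills.BalabanUVNodes.N15KingModelRung.Transl (lapF_inv_transl)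
open Summit.QuantumFields.YangMills.BalabanUVNodes.N15KingModelRung.FreeField (gaussLaw gaussLaw_eq_gaussianFieldOfKernel)

variable {d : ℕ}

/-! ## §1 The site reflection `σ′_κ : x_κ ↦ −x_κ`, the closed half `{val x_κ ≤ K_κ∕2}`, the bonds across -/

section Sites

variable {K : Fin (d + 1) → ℕ} [∀ μ, NeZero (K μ)] (κ : Fin (d + 1))

omit [∀ μ, NeZero (K μ)] in
/-- `σ′_κ x = σ_κ x + e_κ`: the site reflection is the block-face reflection followed by a unit step. [cite: FILS1978, §2] -/
theorem torNeg_eq_torRefl_add (x : Tor K) : torNeg K κ x = torRefl K κ x + unitVec K κ := by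
  funext μ
  by_cases hμ : μ = κ
  · subst hμ
    rw [Pi.add_apply, torNeg_apply_same, torRefl_apply_same, unitVec_apply_same']
    ring
  · rw [Pi.add_apply, torNeg_apply_ne _ hμ, torRefl_apply_ne _ hμ, unitVec_apply_ne' hμ, add_zero]

/-- `val (σ′x)_κ = K_κ − val x_κ` unless `x_κ = 0`. [folklore] -/
theorem val_torNeg {x : Tor K} (hx : x κ ≠ 0) : ((torNeg K κ x) κ).val = K κ - (x κ).val := by
  rw [torNeg_apply_same, ZMod.neg_val, if_neg hx]

/-- ★ **The two closed halves cover the torus**: `x ∉ P ⇒ σ′x ∈ P` for `P = {val x_κ ≤ K_κ∕2}` (any `K_κ ≥ 1`). [cite: Biskup2009, §5.1 Def. 5.2] [cite: FILS1978, §2] -/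
theorem torNeg_mem_half_of_not_mem {x : Tor K} (hx : x ∉ {x : Tor K | (x κ).val ≤ K κ / 2}) :
    torNeg K κ x ∈ {x : Tor K | (x κ).val ≤ K κ / 2} := by
  simp only [Set.mem_setOf_eq, not_le] at hx ⊢
  have h0 : x κ ≠ 0 := fun h => by rw [h, ZMod.val_zero] at hx; omega
  have hlt : (x κ).val < K κ := ZMod.val_lt _
  rw [val_torNeg κ h0]
  omega

/-- ★ **The two closed halves overlap only in fixed points**: `x ∈ P`, `σ′x ∈ P ⇒ σ′x = x` (the hyperplanes `x_κ = 0` and, for even `K_κ`, `x_κ = K_κ∕2`).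
[cite: Biskup2009, §5.1 Def. 5.2 (`𝕋_L^+ ∩ 𝕋_L^- = P`)] -/
theorem torNeg_eq_self_of_mem {x : Tor K} (hx : x ∈ {x : Tor K | (x κ).val ≤ K κ / 2}) (hx' : torNeg K κ x ∈ {x : Tor K | (x κ).val ≤ K κ / 2}) :
    torNeg K κ x = x := by
  simp only [Set.mem_setOf_eq] at hx hx'
  unfold torNeg
  rw [Function.update_eq_self_iff]
  by_cases h0 : x κ = 0
  · rw [h0, neg_zero]
  · have hv : ((torNeg K κ x) κ).val = K κ - (x κ).val := val_torNeg κ h0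
    rw [torNeg_apply_same] at hv
    have hlt : (x κ).val < K κ := ZMod.val_lt _
    rw [torNeg_apply_same] at hx'
    apply ZMod.val_injective
    rw [hv]
    omega

/-- A non-fixed site of the closed half has `1 ≤ val x_κ` and `2·val x_κ ≠ K_κ`. [folklore] -/
theorem two_mul_val_ne_of_ne {x : Tor K} (hfix : torNeg K κ x ≠ x) : x κ ≠ 0 ∧ 2 * (x κ).val ≠ K κ := by
  constructor
  · intro h0
    apply hfix
    unfold torNeg
    rw [Function.update_eq_self_iff, h0, neg_zero]
  · intro h2
    apply hfix
    unfold torNeg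
    rw [Function.update_eq_self_iff]
    have h0 : x κ ≠ 0 := fun h => by
      rw [h, ZMod.val_zero, mul_zero] at h2
      exact (NeZero.ne (K κ)) h2.symm
    apply ZMod.val_injective
    rw [ZMod.neg_val, if_neg h0]
    omega

/-- ★ **A bond crossing a hyperplane through sites joins a site to its own mirror image**: if `σ′_κ y = x ± e_μ` with `x, y` non-fixed points of the closed half
torus, then `x = y`. [cite: FILS1978, §2] [cite: GlimmJaffe1987, §7.10 Thm. 7.10.3 (periodic lattice)] -/
theorem eq_of_cut_bond_sites {x y : Tor K} (hx : x ∈ {x : Tor K | (x κ).val ≤ K κ / 2}) (hxf : torNeg K κ x ≠ x)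
    (hy : y ∈ {x : Tor K | (x κ).val ≤ K κ / 2}) (hyf : torNeg K κ y ≠ y) {μ : Fin (d + 1)}
    (h : torNeg K κ y = x + unitVec K μ ∨ torNeg K κ y = x - unitVec K μ) : x = y := by
  simp only [Set.mem_setOf_eq] at hx hy
  obtain ⟨hx0, hx2⟩ := two_mul_val_ne_of_ne κ hxf
  obtain ⟨hy0, hy2⟩ := two_mul_val_ne_of_ne κ hyf
  have hxlt : (x κ).val < K κ := ZMod.val_lt _
  have hylt : (y κ).val < K κ := ZMod.val_lt _
  have hx1 : 1 ≤ (x κ).val := Nat.pos_of_ne_zero (fun h => hx0 ((ZMod.val_eq_zero _).mp h))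
  have hy1 : 1 ≤ (y κ).val := Nat.pos_of_ne_zero (fun h => hy0 ((ZMod.val_eq_zero _).mp h))
  by_cases hμ : μ = κ
  · subst hμ
    have hother : ∀ ν, ν ≠ μ → x ν = y ν := by
      intro ν hν
      rcases h with h | h
      · have e := congr_fun h ν
        rw [torNeg_apply_ne _ hν, Pi.add_apply, unitVec_apply_ne' hν, add_zero] at e
        exact e.symm
      · have e := congr_fun h ν
        rw [torNeg_apply_ne _ hν, Pi.sub_apply, unitVec_apply_ne' hν, sub_zero] at e
        exact e.symm
    have hsame : x μ = y μ := by
      apply ZMod.val_injective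
      rcases h with h | h
      · have e := congr_fun h μ
        rw [torNeg_apply_same, Pi.add_apply, unitVec_apply_same'] at e
        have e2 : (((x μ).val + (y μ).val + 1 : ℕ) : ZMod (K μ)) = 0 := by
          push_cast
          rw [ZMod.natCast_zmod_val, ZMod.natCast_zmod_val]
          linear_combination (-1 : ZMod (K μ)) * e
        have hdvd : K μ ∣ (x μ).val + (y μ).val + 1 := (ZMod.natCast_eq_zero_iff _ _).mp e2
        have hle : K μ ≤ (x μ).val + (y μ).val + 1 := Nat.le_of_dvd (by omega) hdvd
        omega
      · have e := congr_fun h μ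
        rw [torNeg_apply_same, Pi.sub_apply, unitVec_apply_same'] at e
        have e2 : (((x μ).val + (y μ).val - 1 : ℕ) : ZMod (K μ)) = 0 := by
          rw [Nat.cast_sub (by omega)]
          push_cast
          rw [ZMod.natCast_zmod_val, ZMod.natCast_zmod_val]
          linear_combination (-1 : ZMod (K μ)) * e
        have hdvd : K μ ∣ (x μ).val + (y μ).val - 1 := (ZMod.natCast_eq_zero_iff _ _).mp e2
        have hle : K μ ≤ (x μ).val + (y μ).val - 1 := Nat.le_of_dvd (by omega) hdvd
        omega
    funext ν
    by_cases hν : ν = μ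
    · subst hν; exact hsame
    · exact hother ν hν
  · exfalso
    have e : (torNeg K κ y) κ = x κ := by
      rcases h with h | h
      · rw [h, Pi.add_apply, unitVec_apply_ne' (fun h' => hμ h'.symm), add_zero]
      · rw [h, Pi.sub_apply, unitVec_apply_ne' (fun h' => hμ h'.symm), sub_zero]
    rw [torNeg_apply_same] at e
    have e2 : (((x κ).val + (y κ).val : ℕ) : ZMod (K κ)) = 0 := by
      push_cast
      rw [ZMod.natCast_zmod_val, ZMod.natCast_zmod_val]
      linear_combination (-1 : ZMod (K κ)) * e
    have hdvd : K κ ∣ (x κ).val + (y κ).val := (ZMod.natCast_eq_zero_iff _ _).mp e2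
    have hle : K κ ≤ (x κ).val + (y κ).val := Nat.le_of_dvd (by omega) hdvd
    omega

end Sites

/-! ## §2 `B = c(−Δ) + m²` is site-reflection invariant and Markov across the hyperplane; reflection positivity through sites -/

section SitesRP

variable {K : Fin (d + 1) → ℕ} [∀ μ, NeZero (K μ)] (κ : Fin (d + 1))

omit [∀ μ, NeZero (K μ)] in
/-- `B(σ′x, σ′y) = B(x, y)` (block-face reflection ∘ unit translation). [cite: King1986, (4.4) p.670] -/
theorem lapF_torNeg (c m2 : ℝ) (x y : Tor K) : lapF K c m2 (torNeg K κ x) (torNeg K κ y) = lapF K c m2 x y := by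
  rw [torNeg_eq_torRefl_add, torNeg_eq_torRefl_add, lapF_transl, lapF_torRefl]

/-- `B⁻¹(σ′x, σ′y) = B⁻¹(x, y)`. [cite: King1986, (4.4) p.670] -/
theorem lapF_inv_torNeg (c m2 : ℝ) (x y : Tor K) : (lapF K c m2)⁻¹ (torNeg K κ x) (torNeg K κ y) = (lapF K c m2)⁻¹ x y :=
  inv_apply_equiv_of_invariant (Function.Involutive.toPerm (torNeg K κ) torNeg_torNeg) (fun a b => lapF_torNeg κ c m2 a b) x y

/-- `B(x, σ′y) = 0` for distinct non-fixed `x, y` of the closed half. [cite: King1986, (4.4) p.670] [cite: FILS1978, §2] -/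
theorem lapF_apply_torNeg_of_ne (c m2 : ℝ) {x y : Tor K} (hx : x ∈ {x : Tor K | (x κ).val ≤ K κ / 2}) (hxf : torNeg K κ x ≠ x)
    (hy : y ∈ {x : Tor K | (x κ).val ≤ K κ / 2}) (hyf : torNeg K κ y ≠ y) (hxy : x ≠ y) :
    lapF K c m2 x (torNeg K κ y) = 0 := by
  have hne : torNeg K κ y ≠ x := fun h' => by
    have hyP : torNeg K κ y ∈ {x : Tor K | (x κ).val ≤ K κ / 2} := by rw [h']; exact hx
    exact hyf (torNeg_eq_self_of_mem κ hy hyP)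
  have hb1 : ∀ μ, torNeg K κ y ≠ x + unitVec K μ := fun μ h' => hxy (eq_of_cut_bond_sites κ hx hxf hy hyf (Or.inl h'))
  have hb2 : ∀ μ, torNeg K κ y ≠ x - unitVec K μ := fun μ h' => hxy (eq_of_cut_bond_sites κ hx hxf hy hyf (Or.inr h'))
  simp [lapF, hne, hb1, hb2]

omit [∀ μ, NeZero (K μ)] in
/-- `B(x, σ′x) ≤ 0` at a non-fixed point (`c ≥ 0`). [cite: King1986, (4.4) p.670] -/
theorem lapF_apply_torNeg_self_nonpos {c : ℝ} (hc : 0 ≤ c) (m2 : ℝ) {x : Tor K} (hxf : torNeg K κ x ≠ x) :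
    lapF K c m2 x (torNeg K κ x) ≤ 0 := by
  simp only [lapF, hxf, if_false, mul_zero, zero_sub, neg_nonpos]
  exact mul_nonneg hc (Finset.sum_nonneg fun μ _ => add_nonneg (by split_ifs <;> norm_num) (by split_ifs <;> norm_num))

/-- **`B` is Markov across the site hyperplane**: the cut form vanishes-or-is-negative on vectors supported in the open half (`c ≥ 0`). [cite: FILS1978, §2, Thm. 2.1] -/
theorem lapF_cut_nonpos_sites {c : ℝ} (hc : 0 ≤ c) (m2 : ℝ) (w : Tor K → ℝ) (hw : ∀ x, x ∉ {x : Tor K | (x κ).val ≤ K κ / 2} → w x = 0)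
    (hwF : ∀ x, (Function.Involutive.toPerm (torNeg K κ) torNeg_torNeg) x = x → w x = 0) :
    ∑ x, ∑ y, w x * lapF K c m2 x ((Function.Involutive.toPerm (torNeg K κ) torNeg_torNeg) y) * w y ≤ 0 :=
  cut_nonpos_of_noCoupling (θ := Function.Involutive.toPerm (torNeg K κ) torNeg_torNeg) (P := {x : Tor K | (x κ).val ≤ K κ / 2})
    (fun _ hx hxf _ hy hyf hxy => lapF_apply_torNeg_of_ne κ c m2 hx hxf hy hyf hxy) (fun _ _ hxf => lapF_apply_torNeg_self_nonpos κ hc m2 hxf) w hw hwF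

/-- ★★★ **THE MASSIVE FREE LATTICE FIELD IS REFLECTION POSITIVE FOR REFLECTIONS THROUGH SITES**: on EVERY finite torus `Π ℤ∕K_μ` (any sides `K_μ ≥ 1`), every direction
`κ`, `c ≥ 0`, `m² > 0`, `N(0, B⁻¹)` is reflection positive with respect to `x_κ ↦ −x_κ` and the closed half torus `{val x_κ ≤ K_κ∕2}`, on ALL bounded observables measurable
in its coordinates (the tree's `IsReflectionPositive`). [cite: King1986, (2.13) p.653, (4.4) p.670] [cite: GlimmJaffe1987, §7.10 Thm. 7.10.3] [cite: FILS1978, §2, Thm. 2.1] -/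
theorem freeField_isReflectionPositive_throughSites {c m2 : ℝ} (hc : 0 ≤ c) (hm : 0 < m2) :
    IsReflectionPositive (gaussianFieldOfKernel fun z z' : Tor K => (lapF K c m2)⁻¹ z z')
      (Function.Involutive.toPerm (torNeg K κ) torNeg_torNeg) {x : Tor K | (x κ).val ≤ K κ / 2} :=
  gaussianField_isReflectionPositive_of_precision_sites (lapF_posDef hc hm) (Function.Involutive.toPerm (torNeg K κ) torNeg_torNeg)
    torNeg_torNeg (fun x y => lapF_torNeg κ c m2 x y) (fun _ hx => torNeg_mem_half_of_not_mem κ hx) (fun _ hx hx' => torNeg_eq_self_of_mem κ hx hx')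
    (lapF_cut_nonpos_sites κ hc m2)

/-- The real form. [cite: GlimmJaffe1987, §7.10 Thm. 7.10.3] [cite: Biskup2009, §5.1 Def. 5.2] -/
theorem freeField_isReflectionPositiveReal_throughSites {c m2 : ℝ} (hc : 0 ≤ c) (hm : 0 < m2) :
    IsReflectionPositiveReal (gaussianFieldOfKernel fun z z' : Tor K => (lapF K c m2)⁻¹ z z')
      (Function.Involutive.toPerm (torNeg K κ) torNeg_torNeg) {x : Tor K | (x κ).val ≤ K κ / 2} :=
  (freeField_isReflectionPositive_throughSites κ hc hm).real

/-- The vector form with the reflection on the left (for transport to the translates). [cite: GlimmJaffe1987, §7.10 Thm. 7.10.3] -/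
theorem lapF_inv_sites_base_nonneg {c m2 : ℝ} (hc : 0 ≤ c) (hm : 0 < m2) (u : Tor K → ℝ)
    (hu : ∀ x, x ∉ {x : Tor K | (x κ).val ≤ K κ / 2} → u x = 0) :
    0 ≤ ∑ x, ∑ y, u x * (lapF K c m2)⁻¹ (torNeg K κ x) y * u y :=
  reflectedCovariance_nonneg_of_precision_sites' (lapF_posDef hc hm) (θ := Function.Involutive.toPerm (torNeg K κ) torNeg_torNeg) torNeg_torNeg
    (fun x y => lapF_torNeg κ c m2 x y) (P := {x : Tor K | (x κ).val ≤ K κ / 2}) (fun _ hx => torNeg_mem_half_of_not_mem κ hx)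
    (fun _ hx hx' => torNeg_eq_self_of_mem κ hx hx') (lapF_cut_nonpos_sites κ hc m2) u hu

end SitesRP

/-! ## §3 Every translate `x_κ ↦ 2t_κ − x_κ` (the hyperplane through the sites `x_κ = t_κ`) -/

section SitePlanes

variable {K : Fin (d + 1) → ℕ} [∀ μ, NeZero (K μ)] (κ : Fin (d + 1)) (t : Tor K)

omit [∀ μ, NeZero (K μ)] in
/-- `x ↦ σ′_κ(x − t) + t` is an involution. [cite: FILS1978, §2] -/
theorem siteShiftedRefl_involutive : Function.Involutive (fun x : Tor K => torNeg K κ (x - t) + t) := fun x => by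
  simp only [add_sub_cancel_right, torNeg_torNeg, sub_add_cancel]

/-- ★★★ **REFLECTION POSITIVITY THROUGH EVERY SITE HYPERPLANE**: for every `t`, `N(0, B⁻¹)` is reflection positive with respect to `x_κ ↦ 2t_κ − x_κ` and the closed
half `{val (x − t)_κ ≤ K_κ∕2}` (any sides, `c ≥ 0`, `m² > 0`). [cite: King1986, (4.4) p.670] [cite: GlimmJaffe1987, §7.10 Thm. 7.10.3] [cite: FILS1978, §2, Thm. 2.1] -/
theorem freeField_isReflectionPositive_throughSites_plane {c m2 : ℝ} (hc : 0 ≤ c) (hm : 0 < m2) :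
    IsReflectionPositive (gaussianFieldOfKernel fun z z' : Tor K => (lapF K c m2)⁻¹ z z')
      (Function.Involutive.toPerm _ (siteShiftedRefl_involutive κ t)) {x : Tor K | ((x - t) κ).val ≤ K κ / 2} := by
  have htr : ∀ a b (v : Tor K), (lapF K c m2)⁻¹ (a + v) (b + v) = (lapF K c m2)⁻¹ a b := fun a b v => lapF_inv_transl K c m2 a b v
  refine gaussianField_isReflectionPositive_of_vector (isPosSemidefKernel_inv_of_posDef (lapF_posDef hc hm))
    (Function.Involutive.toPerm _ (siteShiftedRefl_involutive κ t)) (fun a b => ?_) (siteShiftedRefl_involutive κ t) ?_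
  · show (lapF K c m2)⁻¹ (torNeg K κ (a - t) + t) (torNeg K κ (b - t) + t) = (lapF K c m2)⁻¹ a b
    rw [htr, lapF_inv_torNeg, ← htr (a - t) (b - t) t, sub_add_cancel, sub_add_cancel]
  · intro u hu
    exact reflected_nonneg_transport (fun z z' => (lapF K c m2)⁻¹ z z') (Equiv.addRight t) (fun a b => htr a b t) (θ := torNeg K κ)
      (θ' := fun x => torNeg K κ (x - t) + t) (fun x => by simp only [Equiv.coe_addRight, add_sub_cancel_right])
      (P := {x : Tor K | (x κ).val ≤ K κ / 2}) (fun x => by simp only [Set.mem_setOf_eq, Equiv.coe_addRight, add_sub_cancel_right])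
      (lapF_inv_sites_base_nonneg κ hc hm) u hu

end SitePlanes

/-! ## §4 On constant tori `(ℤ∕n)^{d+1}`: the tree's FILS `reflectThroughSites κ k` ∕ `halfThroughSites κ k` -/

section FILS

variable {n : ℕ} [NeZero n] (κ : Fin (d + 1))

omit [NeZero n] in
/-- ★ **The shifted site reflection IS the tree's `reflectThroughSites`**: `σ′_κ(x − t) + t = reflectThroughSites κ (t_κ) x` (`x_κ ↦ 2t_κ − x_κ`). [cite: FILS1978, §2] -/
theorem siteRefl_eq_reflectThroughSites (t x : Tor (fun _ : Fin (d + 1) => n)) :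
    torNeg (fun _ : Fin (d + 1) => n) κ (x - t) + t = reflectThroughSites (d := d + 1) (L := n) κ (t κ) x := by
  rw [reflectThroughSites_apply]
  funext μ
  by_cases hμ : μ = κ
  · subst hμ
    rw [Pi.add_apply, torNeg_apply_same, Function.update_self, Pi.sub_apply]
    ring
  · rw [Pi.add_apply, torNeg_apply_ne _ hμ, Function.update_of_ne hμ, Pi.sub_apply, sub_add_cancel]

omit [NeZero n] in
/-- The same as permutations. [cite: FILS1978, §2] -/
theorem siteReflPerm_eq_reflectThroughSites (t : Tor (fun _ : Fin (d + 1) => n)) :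
    Function.Involutive.toPerm _ (siteShiftedRefl_involutive (K := fun _ : Fin (d + 1) => n) κ t) = reflectThroughSites (d := d + 1) (L := n) κ (t κ) :=
  Equiv.ext fun x => siteRefl_eq_reflectThroughSites κ t x

omit [NeZero n] in
/-- ★ **The shifted closed half IS the tree's `halfThroughSites`**: `{val (x − t)_κ ≤ n∕2} = halfThroughSites κ (t_κ)`. [cite: Biskup2009, §5.1 Def. 5.2] -/
theorem siteHalf_eq_halfThroughSites (t : Tor (fun _ : Fin (d + 1) => n)) :
    {x : Tor (fun _ : Fin (d + 1) => n) | ((x - t) κ).val ≤ n / 2} = halfThroughSites (d := d + 1) (L := n) κ (t κ) :=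
  Set.ext fun x => by simp only [Set.mem_setOf_eq, halfThroughSites, Pi.sub_apply]

/-- ★★★ **THE MASSIVE FREE LATTICE FIELD ON `(ℤ∕n)^{d+1}` IS REFLECTION POSITIVE FOR ALL OF THE TREE's FILS REFLECTIONS THROUGH SITES**: for every `n ≥ 1`, direction
`κ`, `k : ℤ∕n`, `c ≥ 0`, `m² > 0`: `IsReflectionPositive (N(0, B⁻¹)) (Torus.reflectThroughSites κ k) (Torus.halfThroughSites κ k)`.
[cite: King1986, (2.13) p.653, (4.4) p.670] [cite: FILS1978, §2, Thm. 2.1] [cite: Biskup2009, §5.1 Def. 5.2] [cite: GlimmJaffe1987, §7.10 Thm. 7.10.3] -/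
theorem freeField_isReflectionPositive_reflectThroughSites {c m2 : ℝ} (hc : 0 ≤ c) (hm : 0 < m2) (k : ZMod n) :
    IsReflectionPositive (gaussianFieldOfKernel fun z z' : Tor (fun _ : Fin (d + 1) => n) => (lapF (fun _ : Fin (d + 1) => n) c m2)⁻¹ z z')
      (reflectThroughSites (d := d + 1) (L := n) κ k) (halfThroughSites (d := d + 1) (L := n) κ k) := by
  set t : Tor (fun _ : Fin (d + 1) => n) := Pi.single κ k with ht
  have htk : t κ = k := by rw [ht, Pi.single_eq_same]
  have e1 := siteReflPerm_eq_reflectThroughSites κ t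
  have e2 := siteHalf_eq_halfThroughSites κ t
  rw [htk] at e1 e2
  rw [← e1, ← e2]
  exact freeField_isReflectionPositive_throughSites_plane κ t hc hm

variable (L : ℕ)

/-- ★★ **KING's FINE FREE FIELD** on the King-model family's fine tori `Π ℤ∕(L^K·2L^m)` (`fine (L^K) (kingVol L j) = fun _ => L^K·(2L^m)`, `c = (L^K)²`, `m² > 0`) is
reflection positive for every FILS reflection through sites, every direction, every index. [cite: King1986, (2.13) p.653, (4.4) p.670] [cite: FILS1978, §2, Thm. 2.1] -/
theorem kingFineField_isReflectionPositive_reflectThroughSites (hL : 2 ≤ L) {m2 : ℝ} (hm : 0 < m2) (j : KingVolIndex d)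
    (k : ZMod (L ^ j.K * (2 * L ^ j.m))) :
    haveI : NeZero (L ^ j.K * (2 * L ^ j.m)) := ⟨Nat.pos_iff_ne_zero.mp (by positivity)⟩
    IsReflectionPositive
      (gaussianFieldOfKernel fun z z' : Tor (fun _ : Fin (d + 1) => L ^ j.K * (2 * L ^ j.m)) =>
        (lapF (fun _ : Fin (d + 1) => L ^ j.K * (2 * L ^ j.m)) (((L ^ j.K : ℕ) : ℝ) ^ 2) m2)⁻¹ z z')
      (reflectThroughSites (d := d + 1) (L := L ^ j.K * (2 * L ^ j.m)) κ k) (halfThroughSites (d := d + 1) (L := L ^ j.K * (2 * L ^ j.m)) κ k) := by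
  haveI : NeZero (L ^ j.K * (2 * L ^ j.m)) := ⟨Nat.pos_iff_ne_zero.mp (by positivity)⟩
  exact freeField_isReflectionPositive_reflectThroughSites κ (by positivity) hm k

/-- The King-model family's fine torus IS `fun _ => L^K·(2L^m)` (`fine (L^K) (kingVol L j)`, definitionally). [cite: King1986, (2.10) p.652] -/
theorem fine_kingVol_eq (j : KingVolIndex d) : fine (L ^ j.K) (kingVol L j) = fun _ : Fin (d + 1) => L ^ j.K * (2 * L ^ j.m) := rfl

end FILS

end Summit.QuantumFields.YangMills.BalabanUVNodes.N15KingModelRung.TorusRP
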